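import Summits.NavierStokesRegularity.NavierStokesRegularity.Theorems.OddMorawetzLocal.Negative.OddMorawetzLocalSymmetryFields
import Summits.NavierStokesRegularity.NavierStokesRegularity.Theorems.OddMorawetzOddMorawetzLocalStubFluxTransfer
import Summits.NavierStokesRegularity.NavierStokesRegularity.Theorems.OddMorawetzOddMorawetzLocalStubJetDecay
import Literature.Analysis.FluidPDE.TaoAveragedEulerContDiff

/-!
# Crux `OddMorawetzLocal` (stmt-NavierStokesRegularity-1376) — reduction to `B₃`-invariant densities

Negative knowledge for the hunt (`Theorems/OddMorawetzLocal/Negative/`): **`oddMorawetzLocal_iff_b3Invariant`** —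
`OddMorawetzLocal` holds iff it has a witness `(k, m)` whose density is invariant under the hyperoctahedral group
`B₃` of the 48 signed coordinate permutations (acting on 3-jets by `jetAct`). Given any witness, its `B₃`-average
`m̄ = 48⁻¹ ∑_g m ∘ jetAct g` (`b3Average`) is smooth, cubic, of the same weight (`contDiff_/cubic_/weight_b3Average`),
`B₃`-invariant (`b3Average_invariant`, reindexing the finite group), and
`Q_{m̄}(v) = 48⁻¹ ∑_g Q_m(g_* v)` (`integral_b3Average`: rotation covariance of `eulerBilinear` and of the jets from
`OddMorawetzLocalSymmetryFields`, chain rule through `jetAct`, change of variables, and the integrability of each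
`Dm(Jv)[J B(v,v)]` — `integrable_fderiv_jets`, from the landed `stub_jetDecay` and `StubFluxTransfer.jet_bounds /
integrable_pairing`), which is `≥ 0` on divergence-free Schwartz fields and `> 0` at the original strict witness
(the `g = 1` term). Consequence for the refutation programme: at each (odd) weight the hunt is a finite-dimensional
cone over the `B₃`-invariant cubic jet forms — orbit sums of monomials, an elementary description for a finite group
of signed permutations (no invariant theory). Everything is proved; no definitions, no named facts.
-/

noncomputable section

open MeasureTheory FourierTransform
open Literature.Analysis Literature.Analysis.FluidPDE Literature.Analysis.FunctionSpaces

set_option linter.dupNamespace false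

namespace Summit.NavierStokesRegularity.NavierStokesRegularity.Theorems.OddMorawetz

/-! ### Part Q — the Euler-derivative integrand under rotations; integrability; the average -/

section Functional

variable {m : Jet3 → ℝ} {v : E3 → E3}

/-- **Rotation covariance of the Euler-derivative integral**: for a signed permutation `g`,
`∫ Dm(J(g_*v))[J B(g_*v, g_*v)] = ∫ D(m ∘ jetAct g)(Jv)[J B(v,v)]` (i.e. `Q_m(g_*v) = Q_{m∘jetAct g}(v)`). -/
theorem integral_fderiv_rotateField (hm : Differentiable ℝ m) (σ : Equiv.Perm (Fin 3)) (ε : Fin 3 → ℤˣ)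
    (hv : IsSchwartzField v) :
    (∫ x, fderiv ℝ m ((rotateField (signedPerm σ ε) v x, iteratedFDeriv ℝ 1 (rotateField (signedPerm σ ε) v) x,
        iteratedFDeriv ℝ 2 (rotateField (signedPerm σ ε) v) x, iteratedFDeriv ℝ 3 (rotateField (signedPerm σ ε) v) x) : Jet3)
        ((eulerBilinear (rotateField (signedPerm σ ε) v) (rotateField (signedPerm σ ε) v) x,
          iteratedFDeriv ℝ 1 (eulerBilinear (rotateField (signedPerm σ ε) v) (rotateField (signedPerm σ ε) v)) x,
          iteratedFDeriv ℝ 2 (eulerBilinear (rotateField (signedPerm σ ε) v) (rotateField (signedPerm σ ε) v)) x,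
          iteratedFDeriv ℝ 3 (eulerBilinear (rotateField (signedPerm σ ε) v) (rotateField (signedPerm σ ε) v)) x) : Jet3)) =
      ∫ y, fderiv ℝ (m ∘ ⇑(jetAct (signedPerm σ ε)))
        ((v y, iteratedFDeriv ℝ 1 v y, iteratedFDeriv ℝ 2 v y, iteratedFDeriv ℝ 3 v y) : Jet3)
        ((eulerBilinear v v y, iteratedFDeriv ℝ 1 (eulerBilinear v v) y, iteratedFDeriv ℝ 2 (eulerBilinear v v) y,
          iteratedFDeriv ℝ 3 (eulerBilinear v v) y) : Jet3) := by
  have hvs : ContDiff ℝ (⊤ : ℕ∞) v := ((isSchwartzField_iff v).1 hv).1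
  have hbs : ContDiff ℝ (⊤ : ℕ∞) (eulerBilinear v v) := (contDiff_eulerBilinear_holds hv hv).1
  rw [eulerBilinear_rotateField (hvs.differentiable (by simp)) σ ε]
  simp_rw [jet_rotateField hvs, jet_rotateField hbs, ← fderiv_comp_jetAct hm]
  exact ((signedPerm σ ε).symm.measurePreserving).integral_comp
    (signedPerm σ ε).symm.toHomeomorph.measurableEmbedding
    (fun y => fderiv ℝ (m ∘ ⇑(jetAct (signedPerm σ ε)))
      ((v y, iteratedFDeriv ℝ 1 v y, iteratedFDeriv ℝ 2 v y, iteratedFDeriv ℝ 3 v y) : Jet3)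
      ((eulerBilinear v v y, iteratedFDeriv ℝ 1 (eulerBilinear v v) y, iteratedFDeriv ℝ 2 (eulerBilinear v v) y,
        iteratedFDeriv ℝ 3 (eulerBilinear v v) y) : Jet3))

/-- Schwartz fields have uniformly `(1+|x|)⁴`-decaying jets of order `≤ 4` (the hypothesis shape of
`StubFluxTransfer.jet_bounds`). -/
theorem schwartz_decay_four (hv : IsSchwartzField v) :
    ∃ A : ℝ, ∀ n : ℕ, n ≤ 4 → ∀ x : E3, (1 + ‖x‖) ^ 4 * ‖iteratedFDeriv ℝ n v x‖ ≤ A := by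
  obtain ⟨f, rfl⟩ := hv
  choose C hC using fun n : ℕ => f.decay' 4 n
  choose C0 hC0 using fun n : ℕ => f.decay' 0 n
  refine ⟨∑ n ∈ Finset.range 5, 8 * (|C0 n| + |C n|), fun n hn x => ?_⟩
  have h1 : (1 + ‖x‖) ^ 4 ≤ 8 * (1 + ‖x‖ ^ 4) := by
    have := norm_nonneg x
    nlinarith [sq_nonneg (‖x‖ - 1), sq_nonneg (‖x‖ + 1), sq_nonneg ‖x‖, mul_nonneg this (sq_nonneg (‖x‖ - 1))]
  have hn0 := hC0 n x
  have hn4 := hC n x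
  simp only [pow_zero, one_mul] at hn0
  have hterm : (1 + ‖x‖) ^ 4 * ‖iteratedFDeriv ℝ n (⇑f) x‖ ≤ 8 * (|C0 n| + |C n|) := by
    calc (1 + ‖x‖) ^ 4 * ‖iteratedFDeriv ℝ n (⇑f) x‖ ≤ 8 * (1 + ‖x‖ ^ 4) * ‖iteratedFDeriv ℝ n (⇑f) x‖ :=
          mul_le_mul_of_nonneg_right h1 (norm_nonneg _)
      _ = 8 * (‖iteratedFDeriv ℝ n (⇑f) x‖ + ‖x‖ ^ 4 * ‖iteratedFDeriv ℝ n (⇑f) x‖) := by ring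
      _ ≤ 8 * (|C0 n| + |C n|) := by
          gcongr
          · exact hn0.trans (le_abs_self _)
          · exact hn4.trans (le_abs_self _)
  refine hterm.trans ?_
  have hmem : n ∈ Finset.range 5 := Finset.mem_range.2 (by omega)
  exact Finset.single_le_sum (f := fun n => 8 * (|C0 n| + |C n|)) (fun i _ => by positivity) hmem

/-- **Integrability of the Euler-derivative integrand** `x ↦ Dm(Jv x)[J B(v,v) x]` for a `C¹` density and a
divergence-free Schwartz field: both jets are `O((1+|x|)⁻⁴)` (`schwartz_decay_four`, the landed `stub_jetDecay`)
and `Dm` is bounded on the compact range of `Jv` (`StubFluxTransfer.integrable_pairing`). -/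
theorem integrable_fderiv_jets (hm : ContDiff ℝ 1 m) (hv : IsSchwartzField v) (hd : VectorCalculus.IsDivFree v) :
    Integrable fun x => fderiv ℝ m ((v x, iteratedFDeriv ℝ 1 v x, iteratedFDeriv ℝ 2 v x, iteratedFDeriv ℝ 3 v x) : Jet3)
      ((eulerBilinear v v x, iteratedFDeriv ℝ 1 (eulerBilinear v v) x, iteratedFDeriv ℝ 2 (eulerBilinear v v) x,
        iteratedFDeriv ℝ 3 (eulerBilinear v v) x) : Jet3) := by
  haveI := StubFluxTransfer.finiteDimensional_continuousMultilinearMap 1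
  haveI := StubFluxTransfer.finiteDimensional_continuousMultilinearMap 2
  haveI := StubFluxTransfer.finiteDimensional_continuousMultilinearMap 3
  have hvs : ContDiff ℝ (⊤ : ℕ∞) v := ((isSchwartzField_iff v).1 hv).1
  obtain ⟨A, hA⟩ := schwartz_decay_four hv
  obtain ⟨hb, C, hC⟩ := Summit.NavierStokesRegularity.NavierStokesRegularity.Theorems.stub_jetDecay v hv hd
  obtain ⟨hJv, hJv0, -⟩ := StubFluxTransfer.jet_bounds hvs hA
  obtain ⟨hJb, hJb0, -⟩ := StubFluxTransfer.jet_bounds hb hC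
  exact StubFluxTransfer.integrable_pairing hJv.continuous hJb.continuous hJv0 hJb0 hm

/-- The `B₃`-average is smooth. -/
theorem contDiff_b3Average (hm : ContDiff ℝ (⊤ : ℕ∞) m) : ContDiff ℝ (⊤ : ℕ∞) (b3Average m) := by
  unfold b3Average
  refine contDiff_const.mul (ContDiff.sum fun p _ => ?_)
  exact hm.comp (jetAct (signedPerm p.1 p.2)).contDiff

/-- The `B₃`-average of a cubic form is a cubic form. -/
theorem cubic_b3Average (hcub : ∀ (μ : ℝ) (z : Jet3), m (μ • z) = μ ^ 3 * m z) (μ : ℝ) (z : Jet3) :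
    b3Average m (μ • z) = μ ^ 3 * b3Average m z := by
  simp only [b3Average, map_smul, hcub]
  rw [Finset.mul_sum, Finset.mul_sum, Finset.mul_sum]
  refine Finset.sum_congr rfl fun p _ => by ring

/-- The `B₃`-average keeps the derivative weight. -/
theorem weight_b3Average {k : ℕ}
    (hwt : ∀ (s : ℝ), 0 < s → ∀ (z₀ : E3) (z₁ : E3 [×1]→L[ℝ] E3) (z₂ : E3 [×2]→L[ℝ] E3) (z₃ : E3 [×3]→L[ℝ] E3),
      m (z₀, s • z₁, (s ^ 2) • z₂, (s ^ 3) • z₃) = s ^ k * m (z₀, z₁, z₂, z₃))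
    (s : ℝ) (hs : 0 < s) (z₀ : E3) (z₁ : E3 [×1]→L[ℝ] E3) (z₂ : E3 [×2]→L[ℝ] E3) (z₃ : E3 [×3]→L[ℝ] E3) :
    b3Average m (z₀, s • z₁, (s ^ 2) • z₂, (s ^ 3) • z₃) = s ^ k * b3Average m (z₀, z₁, z₂, z₃) := by
  simp only [b3Average, jetAct_apply, map_smul]
  rw [Finset.mul_sum, Finset.mul_sum, Finset.mul_sum]
  refine Finset.sum_congr rfl fun p _ => ?_
  rw [hwt s hs]
  ring

/-- The `B₃`-average is `B₃`-invariant. -/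
theorem b3Average_invariant (m : Jet3 → ℝ) (σ₀ : Equiv.Perm (Fin 3)) (ε₀ : Fin 3 → ℤˣ) :
    b3Average m ∘ ⇑(jetAct (signedPerm σ₀ ε₀)) = b3Average m := by
  funext z
  simp only [Function.comp_apply, b3Average, jetAct_jetAct, signedPerm_trans]
  congr 1
  exact (b3_translate_bijective σ₀ ε₀).sum_comp
    (fun q : Equiv.Perm (Fin 3) × (Fin 3 → ℤˣ) => m (jetAct (signedPerm q.1 q.2) z))

/-- Derivative of the `B₃`-average: the average of the derivatives of the translates. -/
theorem fderiv_b3Average (hm : ContDiff ℝ (⊤ : ℕ∞) m) (z w : Jet3) :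
    fderiv ℝ (b3Average m) z w =
      (48 : ℝ)⁻¹ * ∑ p : Equiv.Perm (Fin 3) × (Fin 3 → ℤˣ), fderiv ℝ (m ∘ ⇑(jetAct (signedPerm p.1 p.2))) z w := by
  have hdiff : ∀ p : Equiv.Perm (Fin 3) × (Fin 3 → ℤˣ),
      DifferentiableAt ℝ (m ∘ ⇑(jetAct (signedPerm p.1 p.2))) z := fun p =>
    ((hm.comp (jetAct (signedPerm p.1 p.2)).contDiff).differentiable (by simp)) z
  have h1 : b3Average m = fun z => (48 : ℝ)⁻¹ * ∑ p : Equiv.Perm (Fin 3) × (Fin 3 → ℤˣ),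
      (m ∘ ⇑(jetAct (signedPerm p.1 p.2))) z := by
    funext z; simp [b3Average]
  rw [h1, fderiv_const_mul (DifferentiableAt.fun_sum fun p _ => hdiff p), fderiv_fun_sum fun p _ => hdiff p]
  simp

/-- **The Euler derivative of the average is the average of the Euler derivatives of the rotated fields**:
`-∫ Dm̄(Jv)[J B(v,v)] = 48⁻¹ ∑_g (-∫ Dm(J(g_*v))[J B(g_*v, g_*v)])` for divergence-free Schwartz `v`. -/
theorem integral_b3Average (hm : ContDiff ℝ (⊤ : ℕ∞) m) (hv : IsSchwartzField v) (hd : VectorCalculus.IsDivFree v) :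
    (∫ x, fderiv ℝ (b3Average m) ((v x, iteratedFDeriv ℝ 1 v x, iteratedFDeriv ℝ 2 v x, iteratedFDeriv ℝ 3 v x) : Jet3)
        ((eulerBilinear v v x, iteratedFDeriv ℝ 1 (eulerBilinear v v) x, iteratedFDeriv ℝ 2 (eulerBilinear v v) x,
          iteratedFDeriv ℝ 3 (eulerBilinear v v) x) : Jet3)) =
      (48 : ℝ)⁻¹ * ∑ p : Equiv.Perm (Fin 3) × (Fin 3 → ℤˣ),
        ∫ x, fderiv ℝ m ((rotateField (signedPerm p.1 p.2) v x, iteratedFDeriv ℝ 1 (rotateField (signedPerm p.1 p.2) v) x,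
            iteratedFDeriv ℝ 2 (rotateField (signedPerm p.1 p.2) v) x,
            iteratedFDeriv ℝ 3 (rotateField (signedPerm p.1 p.2) v) x) : Jet3)
          ((eulerBilinear (rotateField (signedPerm p.1 p.2) v) (rotateField (signedPerm p.1 p.2) v) x,
            iteratedFDeriv ℝ 1 (eulerBilinear (rotateField (signedPerm p.1 p.2) v) (rotateField (signedPerm p.1 p.2) v)) x,
            iteratedFDeriv ℝ 2 (eulerBilinear (rotateField (signedPerm p.1 p.2) v) (rotateField (signedPerm p.1 p.2) v)) x,
            iteratedFDeriv ℝ 3 (eulerBilinear (rotateField (signedPerm p.1 p.2) v) (rotateField (signedPerm p.1 p.2) v)) x) :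
              Jet3) := by
  simp_rw [fderiv_b3Average hm, integral_fderiv_rotateField (hm.differentiable (by simp)) _ _ hv]
  rw [integral_const_mul, integral_finsetSum]
  intro p _
  exact integrable_fderiv_jets ((hm.comp (jetAct (signedPerm p.1 p.2)).contDiff).of_le (by simp)) hv hd

end Functional

/-! ### Part A — the reduction of the crux to `B₃`-invariant densities -/

section Reduction

/-- **Symmetry reduction of the hunt.** `OddMorawetzLocal` holds iff it has a witness `(k, m)` whose density is
invariant under the hyperoctahedral group `B₃` of signed coordinate permutations (acting on 3-jets by `jetAct`):
given any witness, its `B₃`-average `m̄ = 48⁻¹ ∑_g m ∘ jetAct g` is admissible, `B₃`-invariant, and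
`Q_{m̄}(v) = 48⁻¹ ∑_g Q_m(g_* v)` (rotation covariance of `eulerBilinear`, chain rule, change of variables, and the
integrability of each `Dm(Jv)[J B(v,v)]` from the landed `stub_jetDecay` / `StubFluxTransfer` bounds), which is
`≥ 0` on divergence-free Schwartz fields and `> 0` at the original strict witness (the `g = 1` term).
Consequence: at each weight the hunt is a finite-dimensional cone over the `B₃`-invariant cubic jet forms (orbit sums
of monomials), with no appeal to invariant theory. -/
theorem oddMorawetzLocal_iff_b3Invariant :
    Summit.NavierStokesRegularity.NavierStokesRegularity.Theses.OddMorawetz.OddMorawetzLocal ↔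
      ∃ (k : ℕ) (m : EuclideanSpace ℝ (Fin 3) × (EuclideanSpace ℝ (Fin 3) [×1]→L[ℝ] EuclideanSpace ℝ (Fin 3)) × (EuclideanSpace ℝ (Fin 3) [×2]→L[ℝ] EuclideanSpace ℝ (Fin 3)) × (EuclideanSpace ℝ (Fin 3) [×3]→L[ℝ] EuclideanSpace ℝ (Fin 3)) → ℝ),
        (∀ (σ : Equiv.Perm (Fin 3)) (ε : Fin 3 → ℤˣ), m ∘ ⇑(jetAct (signedPerm σ ε)) = m) ∧
        (let J := fun (v : EuclideanSpace ℝ (Fin 3) → EuclideanSpace ℝ (Fin 3)) (x : EuclideanSpace ℝ (Fin 3)) => (v x, iteratedFDeriv ℝ 1 v x, iteratedFDeriv ℝ 2 v x, iteratedFDeriv ℝ 3 v x); let Q := fun (v : EuclideanSpace ℝ (Fin 3) → EuclideanSpace ℝ (Fin 3)) => -∫ x, fderiv ℝ m (J v x) (J (Literature.Analysis.FluidPDE.eulerBilinear v v) x); k ≤ 5 ∧ ContDiff ℝ (⊤ : ℕ∞) m ∧ (∀ (μ : ℝ) z, m (μ • z) = μ ^ 3 * m z) ∧ (∀ (s : ℝ),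 0 < s → ∀ (z₀ : EuclideanSpace ℝ (Fin 3)) (z₁ : EuclideanSpace ℝ (Fin 3) [×1]→L[ℝ] EuclideanSpace ℝ (Fin 3)) (z₂ : EuclideanSpace ℝ (Fin 3) [×2]→L[ℝ] EuclideanSpace ℝ (Fin 3)) (z₃ : EuclideanSpace ℝ (Fin 3) [×3]→L[ℝ] EuclideanSpace ℝ (Fin 3)), m (z₀, s • z₁, (s ^ 2) • z₂, (s ^ 3) • z₃) = s ^ k * m (z₀, z₁, z₂, z₃)) ∧ (∀ v, Literature.Analysis.FluidPDE.IsSchwartzField v → Literature.Analysis.FluidPDE.VectorCalculus.IsDivFree v → 0 ≤ Q v) ∧ (∃ v, Literature.Analysis.FluidPDE.IsSchwartzField v ∧ Literature.Analysis.FluidPDE.VectorCalculus.IsDivFree v ∧ 0 < Q v)) := by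
  constructor
  · rintro ⟨k, m, h⟩
    obtain ⟨hk, hm, hcub, hwt, hQ, v₀, hv₀, hd₀, hpos⟩ := h
    refine ⟨k, b3Average m, fun σ ε => b3Average_invariant m σ ε, ?_⟩
    -- the sign of every term of the averaged Euler derivative
    have hterm : ∀ (v : E3 → E3), IsSchwartzField v → VectorCalculus.IsDivFree v →
        ∀ p : Equiv.Perm (Fin 3) × (Fin 3 → ℤˣ),
        0 ≤ -∫ x, fderiv ℝ m ((rotateField (signedPerm p.1 p.2) v x,
            iteratedFDeriv ℝ 1 (rotateField (signedPerm p.1 p.2) v) x,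
            iteratedFDeriv ℝ 2 (rotateField (signedPerm p.1 p.2) v) x,
            iteratedFDeriv ℝ 3 (rotateField (signedPerm p.1 p.2) v) x) : Jet3)
          ((eulerBilinear (rotateField (signedPerm p.1 p.2) v) (rotateField (signedPerm p.1 p.2) v) x,
            iteratedFDeriv ℝ 1 (eulerBilinear (rotateField (signedPerm p.1 p.2) v) (rotateField (signedPerm p.1 p.2) v)) x,
            iteratedFDeriv ℝ 2 (eulerBilinear (rotateField (signedPerm p.1 p.2) v) (rotateField (signedPerm p.1 p.2) v)) x,
            iteratedFDeriv ℝ 3 (eulerBilinear (rotateField (signedPerm p.1 p.2) v) (rotateField (signedPerm p.1 p.2) v)) x) :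
              Jet3) := by
      intro v hv hd p
      have hvs : ContDiff ℝ (⊤ : ℕ∞) v := ((isSchwartzField_iff v).1 hv).1
      have h := hQ (rotateField (signedPerm p.1 p.2) v) (isSchwartzField_rotateField hv _)
        (isDivFree_rotateField (hvs.differentiable (by simp)) hd _)
      beta_reduce at h
      exact h
    have hsum : ∀ (v : E3 → E3), IsSchwartzField v → VectorCalculus.IsDivFree v →
        (-∫ x, fderiv ℝ (b3Average m) ((v x, iteratedFDeriv ℝ 1 v x, iteratedFDeriv ℝ 2 v x, iteratedFDeriv ℝ 3 v x) : Jet3)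
          ((eulerBilinear v v x, iteratedFDeriv ℝ 1 (eulerBilinear v v) x, iteratedFDeriv ℝ 2 (eulerBilinear v v) x,
            iteratedFDeriv ℝ 3 (eulerBilinear v v) x) : Jet3)) =
        (48 : ℝ)⁻¹ * ∑ p : Equiv.Perm (Fin 3) × (Fin 3 → ℤˣ),
          -∫ x, fderiv ℝ m ((rotateField (signedPerm p.1 p.2) v x,
            iteratedFDeriv ℝ 1 (rotateField (signedPerm p.1 p.2) v) x,
            iteratedFDeriv ℝ 2 (rotateField (signedPerm p.1 p.2) v) x,
            iteratedFDeriv ℝ 3 (rotateField (signedPerm p.1 p.2) v) x) : Jet3)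
          ((eulerBilinear (rotateField (signedPerm p.1 p.2) v) (rotateField (signedPerm p.1 p.2) v) x,
            iteratedFDeriv ℝ 1 (eulerBilinear (rotateField (signedPerm p.1 p.2) v) (rotateField (signedPerm p.1 p.2) v)) x,
            iteratedFDeriv ℝ 2 (eulerBilinear (rotateField (signedPerm p.1 p.2) v) (rotateField (signedPerm p.1 p.2) v)) x,
            iteratedFDeriv ℝ 3 (eulerBilinear (rotateField (signedPerm p.1 p.2) v) (rotateField (signedPerm p.1 p.2) v)) x) :
              Jet3) := by
      intro v hv hd
      rw [integral_b3Average hm hv hd, Finset.mul_sum, Finset.mul_sum, ← Finset.sum_neg_distrib]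
      refine Finset.sum_congr rfl fun p _ => by ring
    intro J Q
    refine ⟨hk, contDiff_b3Average hm, cubic_b3Average hcub,
      fun s hs z₀ z₁ z₂ z₃ => weight_b3Average hwt s hs z₀ z₁ z₂ z₃, ?_, v₀, hv₀, hd₀, ?_⟩
    · intro v hv hd
      show 0 ≤ -∫ x, fderiv ℝ (b3Average m) ((v x, iteratedFDeriv ℝ 1 v x, iteratedFDeriv ℝ 2 v x,
          iteratedFDeriv ℝ 3 v x) : Jet3)
        ((eulerBilinear v v x, iteratedFDeriv ℝ 1 (eulerBilinear v v) x, iteratedFDeriv ℝ 2 (eulerBilinear v v) x,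
          iteratedFDeriv ℝ 3 (eulerBilinear v v) x) : Jet3)
      rw [hsum v hv hd]
      exact mul_nonneg (by norm_num) (Finset.sum_nonneg fun p _ => hterm v hv hd p)
    · show 0 < -∫ x, fderiv ℝ (b3Average m) ((v₀ x, iteratedFDeriv ℝ 1 v₀ x, iteratedFDeriv ℝ 2 v₀ x,
          iteratedFDeriv ℝ 3 v₀ x) : Jet3)
        ((eulerBilinear v₀ v₀ x, iteratedFDeriv ℝ 1 (eulerBilinear v₀ v₀) x, iteratedFDeriv ℝ 2 (eulerBilinear v₀ v₀) x,
          iteratedFDeriv ℝ 3 (eulerBilinear v₀ v₀) x) : Jet3)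
      rw [hsum v₀ hv₀ hd₀]
      refine mul_pos (by norm_num) (lt_of_lt_of_le ?_
        (Finset.single_le_sum (fun p _ => hterm v₀ hv₀ hd₀ p)
          (Finset.mem_univ ((1, 1) : Equiv.Perm (Fin 3) × (Fin 3 → ℤˣ)))))
      have h1 := hpos
      beta_reduce at h1
      simp only [signedPerm_one, rotateField_refl]
      exact h1
  · rintro ⟨k, m, -, h⟩
    exact ⟨k, m, h⟩

end Reduction

end Summit.NavierStokesRegularity.NavierStokesRegularity.Theorems.OddMorawetz
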